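import Literature.Geometry.Riemannian.GramOperatorFrameTrace
import HarnessLib

/-!
# Hölder smallness of the frame defect `∑ᵢ D²u(bᵢ, bᵢ) - Δu` as `Du → 0`

Topic `Literature/Geometry/Riemannian` (continuation of `GramOperatorFrameTrace.lean`).  For the
nonparametric description of an almost flat piece of submanifold (White 2005, §8.4 and p. 1505
(9)), the second-order operator `∑ᵢ D²u(bᵢ, bᵢ)` (trace of `D²u` in an induced-orthonormal frame,
`= g^{jk} ∂²_{jk} u`) differs from the flat Laplacian `∑ⱼ D²u(eⱼ, eⱼ)` by

  `Q = ∑ⱼ D²u ((G⁻¹ - 1) eⱼ) eⱼ`,   `G = 1 + Du† Du`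

(`sum_frame_eq_sum_inverse_apply`).  Here we bound `Q` pointwise and in the Hölder sense along a
family `x ↦ (D x, D2 x)` (meant: `X ↦ (Du(X), D²u(X))` on a parabolic ball): if `‖D‖ ≤ δ`,
`‖D2‖ ≤ M` and `D`, `D2` are `α`-Hölder with constants `C₁`, `C₂` on `s`, then
`‖Q‖ ≤ |κ| M δ²` and `Q` is `α`-Hölder with constant `|κ| (C₂ δ² + 2 M δ C₁)`
(`norm_frameDefect_le`, `norm_frameDefect_sub_le`) — both `→ 0` as `δ → 0` with the other
constants bounded, which is White's "(9) converges to `0`" (p. 1505).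

Everything is PROVED; no definitions, no named facts.

## References

* B. White, *A local regularity theorem for mean curvature flow*, Ann. of Math. 161 (2005),
  §8.4, p. 1505. [White2005]
-/

noncomputable section

namespace Literature.Geometry.Riemannian

open scoped RealInnerProductSpace
open Module

variable {E V F : Type*} [NormedAddCommGroup E] [InnerProductSpace ℝ E] [FiniteDimensional ℝ E]
  [NormedAddCommGroup V] [InnerProductSpace ℝ V] [FiniteDimensional ℝ V]
  [NormedAddCommGroup F] [NormedSpace ℝ F]

omit [FiniteDimensional ℝ E] in
/-- One term: `‖B (A e) e‖ ≤ ‖B‖ ‖A‖` for a unit vector `e`. [folklore] -/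
theorem norm_bilin_apply_apply_le (B : E →L[ℝ] E →L[ℝ] F) (A : E →L[ℝ] E) {e : E}
    (he : ‖e‖ = 1) : ‖B (A e) e‖ ≤ ‖B‖ * ‖A‖ := by
  calc ‖B (A e) e‖ ≤ ‖B (A e)‖ * ‖e‖ := (B (A e)).le_opNorm e
    _ ≤ ‖B‖ * ‖A e‖ * ‖e‖ := mul_le_mul_of_nonneg_right (B.le_opNorm _) (norm_nonneg _)
    _ ≤ ‖B‖ * (‖A‖ * ‖e‖) * ‖e‖ :=
        mul_le_mul_of_nonneg_right (mul_le_mul_of_nonneg_left (A.le_opNorm e) (norm_nonneg B))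
          (norm_nonneg _)
    _ = ‖B‖ * ‖A‖ := by rw [he]; ring

omit [FiniteDimensional ℝ E] [FiniteDimensional ℝ V] in
/-- **Pointwise bound of the frame defect**: `‖∑ⱼ D2 ((Gi - 1) eⱼ) eⱼ‖ ≤ |κ| M δ²` when
`‖Gi - 1‖ ≤ ‖D‖²`, `‖D‖ ≤ δ`, `‖D2‖ ≤ M`. [cite: White2005, §8.4 p. 1505] -/
theorem norm_frameDefect_le {κ : Type*} [Fintype κ] (e : OrthonormalBasis κ ℝ E)
    {D : E →L[ℝ] V} {D2 : E →L[ℝ] E →L[ℝ] F} {Gi : E →L[ℝ] E} {δ M : ℝ}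
    (hGi : ‖Gi - 1‖ ≤ ‖D‖ ^ 2) (hD : ‖D‖ ≤ δ) (hD2 : ‖D2‖ ≤ M) :
    ‖∑ j, D2 ((Gi - 1) (e j)) (e j)‖ ≤ Fintype.card κ * (M * δ ^ 2) := by
  have hM : 0 ≤ M := (norm_nonneg D2).trans hD2
  have hA : ‖Gi - 1‖ ≤ δ ^ 2 :=
    hGi.trans (pow_le_pow_left₀ (norm_nonneg _) hD 2)
  calc ‖∑ j, D2 ((Gi - 1) (e j)) (e j)‖ ≤ ∑ j, ‖D2 ((Gi - 1) (e j)) (e j)‖ := norm_sum_le _ _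
    _ ≤ ∑ _j : κ, M * δ ^ 2 := Finset.sum_le_sum fun j _ =>
        (norm_bilin_apply_apply_le D2 (Gi - 1) (e.orthonormal.1 j)).trans
          (mul_le_mul hD2 hA (norm_nonneg _) hM)
    _ = Fintype.card κ * (M * δ ^ 2) := by
        rw [Finset.sum_const, Finset.card_univ, nsmul_eq_mul]

/-- **Hölder-type bound of the frame defect along a family**: with `Gi x` the inverse Gram
operator of `D x` (`Gi (G v) = v`, `G (Gi v) = v`, `‖Gi‖ ≤ 1`), bounds `‖D x‖ ≤ δ`,
`‖D2 x‖ ≤ M` and increments `‖D x - D y‖ ≤ d₁`, `‖D2 x - D2 y‖ ≤ d₂`, the defect increments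
satisfy `‖Q x - Q y‖ ≤ |κ| (d₂ δ² + 2 M δ d₁)`.  (Take `dᵢ = Cᵢ dist(x,y)^α` for the Hölder
statement.) [cite: White2005, §8.4 p. 1505] -/
theorem norm_frameDefect_sub_le {κ : Type*} [Fintype κ] (e : OrthonormalBasis κ ℝ E)
    {D D' : E →L[ℝ] V} {D2 D2' : E →L[ℝ] E →L[ℝ] F} {Gi Gi' : E →L[ℝ] E} {δ M d₁ d₂ : ℝ}
    (hGi : ∀ v, Gi ((1 + D.adjoint ∘L D) v) = v) (hGin : ‖Gi‖ ≤ 1) (hGi1 : ‖Gi - 1‖ ≤ ‖D‖ ^ 2)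
    (hGi' : ∀ v, (1 + D'.adjoint ∘L D') (Gi' v) = v) (hGin' : ‖Gi'‖ ≤ 1)
    (hD : ‖D‖ ≤ δ) (hD' : ‖D'‖ ≤ δ) (hD2' : ‖D2'‖ ≤ M)
    (hd₁ : ‖D - D'‖ ≤ d₁) (hd₂ : ‖D2 - D2'‖ ≤ d₂) :
    ‖∑ j, D2 ((Gi - 1) (e j)) (e j) - ∑ j, D2' ((Gi' - 1) (e j)) (e j)‖ ≤
      Fintype.card κ * (d₂ * δ ^ 2 + 2 * M * δ * d₁) := by
  have hδ : 0 ≤ δ := (norm_nonneg _).trans hD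
  have hM : 0 ≤ M := (norm_nonneg D2').trans hD2'
  have hd₁0 : 0 ≤ d₁ := (norm_nonneg _).trans hd₁
  have hA : ‖Gi - 1‖ ≤ δ ^ 2 := hGi1.trans (pow_le_pow_left₀ (norm_nonneg _) hD 2)
  have hGG : ‖Gi - Gi'‖ ≤ 2 * δ * d₁ := by
    calc ‖Gi - Gi'‖ ≤ (‖D‖ + ‖D'‖) * ‖D - D'‖ := norm_gram_inverse_sub_le hGi hGin hGi' hGin'
      _ ≤ (δ + δ) * d₁ := mul_le_mul (add_le_add hD hD') hd₁ (norm_nonneg _) (by positivity)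
      _ = 2 * δ * d₁ := by ring
  rw [← Finset.sum_sub_distrib]
  calc ‖∑ j, (D2 ((Gi - 1) (e j)) (e j) - D2' ((Gi' - 1) (e j)) (e j))‖
      ≤ ∑ j, ‖D2 ((Gi - 1) (e j)) (e j) - D2' ((Gi' - 1) (e j)) (e j)‖ := norm_sum_le _ _
    _ ≤ ∑ _j : κ, (d₂ * δ ^ 2 + 2 * M * δ * d₁) := Finset.sum_le_sum fun j _ => by
        -- `B(Ae)e - B'(A'e)e = (B - B')(Ae)e + B'((A - A')e)e`, `A - A' = Gi - Gi'`
        have hsplit : D2 ((Gi - 1) (e j)) (e j) - D2' ((Gi' - 1) (e j)) (e j) =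
            (D2 - D2') ((Gi - 1) (e j)) (e j) + D2' ((Gi - Gi') (e j)) (e j) := by
          simp only [sub_apply, map_sub]
          abel
        rw [hsplit]
        calc ‖(D2 - D2') ((Gi - 1) (e j)) (e j) + D2' ((Gi - Gi') (e j)) (e j)‖
            ≤ ‖(D2 - D2') ((Gi - 1) (e j)) (e j)‖ + ‖D2' ((Gi - Gi') (e j)) (e j)‖ :=
              norm_add_le _ _
          _ ≤ ‖D2 - D2'‖ * ‖Gi - 1‖ + ‖D2'‖ * ‖Gi - Gi'‖ :=
              add_le_add (norm_bilin_apply_apply_le _ _ (e.orthonormal.1 j))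
                (norm_bilin_apply_apply_le _ _ (e.orthonormal.1 j))
          _ ≤ d₂ * δ ^ 2 + M * (2 * δ * d₁) :=
              add_le_add (mul_le_mul hd₂ hA (norm_nonneg _) ((norm_nonneg (D2 - D2')).trans hd₂))
                (mul_le_mul hD2' hGG (norm_nonneg _) hM)
          _ = d₂ * δ ^ 2 + 2 * M * δ * d₁ := by ring
    _ = Fintype.card κ * (d₂ * δ ^ 2 + 2 * M * δ * d₁) := by
        rw [Finset.sum_const, Finset.card_univ, nsmul_eq_mul]

end Literature.Geometry.Riemannian
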